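import Summits.AtomisticToContinuum.Crystallization.Theorems.ExcessDecayLiouvilleHcpLiouvilleLevelOneGrowth
import Summits.AtomisticToContinuum.Crystallization.Theorems.ExcessDecayLiouvilleHcpLiouvilleBlowdownDefs

/-!
# `ExcessDecayLiouville.HcpLiouville` (stmt-AtomisticToContinuum-9332), line `Sketch` (skeleton v4): rows of the secant form for the cut-off field with a common constant

Helper for stub `stub_caccioppoli` (interface `Blowdown.CaccioppoliProp`).  In the anchored setting of
`…HcpLiouvilleLinearEq.lean` / `…HcpLiouvilleLevelOneGrowth.lean` (admissible hcp datum `(t, A)`, equilibrium `X`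
in displacement form `u`, relaxed anchor `τ`, anchored sites `S* = Sites₀ (anchorDatum t τ) A`, displacement
`v = LevelOne.vField t A τ u`, secant matrices `B_pq(w, w') = LevelOne.secK (p − q) (v p − v q) w w'`, cut-off
`χ = LevelOne.cutoff S* c R`) we redo the row book-keeping of the nonlinear Caccioppoli estimate
`LevelOne.secFormAt_cutoff_le` for the test field `χ • (v − m)` with a COMMON constant `m` (`‖m‖ ≤ 1`).
Translations are exact symmetries (`D(v − m) = Dv`), so the row identity and the summation by parts go through
verbatim; the second part is bounded keeping the squares `‖v p − m‖²` (`ab ≤ (a² + b²)/2`):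

* `Blowdown.oscAt_eq_tsum_ite`, `Blowdown.nnEnergy_eq_tsum_ite` — the blow-down functionals as `tsum`s over the
  site subtype; `Blowdown.oscAt_le_of_sq_le` — the counting bound `oscAt ≤ b·32r³`;
* `Blowdown.tsum_first_part_sub_eq_zero` — summation by parts `Σ_p Σ_q B_pq(Dv, χ_q²(v_q − m)) = 0`;
* `Blowdown.row_identity_sub` —
  `Σ_q B_pq(D(χ(v−m)), D(χ(v−m))) = −Σ_q B_pq(Dv, χ_q²(v_q − m)) + Σ_q (χ_p − χ_q)² B_pq(v_p − m, v_q − m)`;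
* `Blowdown.abs_T_sub_le_half` —
  `|Σ_q (χ_p − χ_q)² B_pq(v_p − m, v_q − m)| ≤ ½(‖v_p − m‖² Σ_q (χ_p − χ_q)² k + Σ_q (χ_p − χ_q)² k ‖v_q − m‖²)`,
  and the summability of the second part `Blowdown.summable_T_sub`.

All `[folklore]`; a `--supports` helper for item stmt-AtomisticToContinuum-9332, nothing here closes an item.
-/
noncomputable section

namespace Summit.AtomisticToContinuum.Crystallization.Theorems.ExcessDecayLiouville

open scoped BigOperators Topology Classical InnerProductSpace RealInnerProductSpace
open Literature.MathematicalPhysics.StatisticalMechanics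
open Summit.AtomisticToContinuum.Crystallization.Theses.ExcessDecayLiouville
open Summit.AtomisticToContinuum.Crystallization.Theorems.PhononStabilityNegative

local notation "E3" => EuclideanSpace ℝ (Fin 3)

namespace Blowdown

open LevelOne

variable {t : Fin 2 → E3} {A : E3 →L[ℝ] E3} {τ : E3} {X : Set E3} {u : E3 → E3}

/-! ## The squared oscillation as a `tsum` over the site subtype -/

/-- `oscAt S v c r m = Σ'_{p ∈ S} [dist p c ≤ r] ‖v p − m‖²`. [folklore] -/
theorem oscAt_eq_tsum_ite (S : Set E3) (v : E3 → E3) (c : E3) (r : ℝ) (m : E3) :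
    oscAt S v c r m = ∑' p : S, if dist (p : E3) c ≤ r then ‖v p - m‖ ^ 2 else 0 := by
  have h1 := tsum_subtype {s : E3 | s ∈ S ∧ dist s c ≤ r} (fun p => ‖v p - m‖ ^ 2)
  have h2 := tsum_subtype S (fun p => if dist p c ≤ r then ‖v p - m‖ ^ 2 else 0)
  refine (h1.trans (tsum_congr fun x => ?_)).trans h2.symm
  by_cases hx : x ∈ S
  · by_cases hd : dist x c ≤ r
    · rw [Set.indicator_of_mem (show x ∈ {s : E3 | s ∈ S ∧ dist s c ≤ r} from ⟨hx, hd⟩),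
        Set.indicator_of_mem hx, if_pos hd]
    · rw [Set.indicator_of_notMem (show x ∉ {s : E3 | s ∈ S ∧ dist s c ≤ r} from fun h => hd h.2),
        Set.indicator_of_mem hx, if_neg hd]
  · rw [Set.indicator_of_notMem (show x ∉ {s : E3 | s ∈ S ∧ dist s c ≤ r} from fun h => hx h.1),
      Set.indicator_of_notMem hx]

/-- `nnEnergy S v c r = Σ'_{p ∈ S} [dist p c ≤ r] Σ'_{q ∈ S} [dist p q ≤ 11/10] ‖v p − v q‖²`. [folklore] -/
theorem nnEnergy_eq_tsum_ite (S : Set E3) (v : E3 → E3) (c : E3) (r : ℝ) :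
    nnEnergy S v c r = ∑' p : S, if dist (p : E3) c ≤ r then
      ∑' q : S, (if dist (p : E3) q ≤ 11 / 10 then ‖v p - v q‖ ^ 2 else 0) else 0 := by
  have h1 := tsum_subtype {s : E3 | s ∈ S ∧ dist s c ≤ r}
    (fun p => ∑' q : S, (if dist p q ≤ 11 / 10 then ‖v p - v q‖ ^ 2 else 0))
  have h2 := tsum_subtype S (fun p => if dist p c ≤ r then
    ∑' q : S, (if dist p q ≤ 11 / 10 then ‖v p - v q‖ ^ 2 else 0) else 0)
  refine (h1.trans (tsum_congr fun x => ?_)).trans h2.symm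
  by_cases hx : x ∈ S
  · by_cases hd : dist x c ≤ r
    · rw [Set.indicator_of_mem (show x ∈ {s : E3 | s ∈ S ∧ dist s c ≤ r} from ⟨hx, hd⟩),
        Set.indicator_of_mem hx, if_pos hd]
    · rw [Set.indicator_of_notMem (show x ∉ {s : E3 | s ∈ S ∧ dist s c ≤ r} from fun h => hd h.2),
        Set.indicator_of_mem hx, if_neg hd]
  · rw [Set.indicator_of_notMem (show x ∉ {s : E3 | s ∈ S ∧ dist s c ≤ r} from fun h => hx h.1),
      Set.indicator_of_notMem hx]

/-! ## Pointwise bounds for the shifted field `v − m` -/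

/-- `‖v p − m‖ ≤ 11/10` on the anchored sites (`‖v‖ ≤ 3/40`, `‖m‖ ≤ 1`). [folklore] -/
theorem norm_vField_sub_const_le (hA : Adm₀ A) (hI : Inner₀ t A) (hIτ : Inner₀ (anchorDatum t τ) A)
    (hu : IsDisplacement X t A u) {m : E3} (hm : ‖m‖ ≤ 1) {p : E3} (hp : p ∈ Sites₀ (anchorDatum t τ) A) :
    ‖vField t A τ u p - m‖ ≤ 11 / 10 :=
  (norm_sub_le _ _).trans (by linarith [norm_vField_le hA hI hIτ hu hp])

/-- `‖v p − m‖² ≤ 121/100` on the anchored sites. [folklore] -/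
theorem sq_norm_vField_sub_const_le (hA : Adm₀ A) (hI : Inner₀ t A) (hIτ : Inner₀ (anchorDatum t τ) A)
    (hu : IsDisplacement X t A u) {m : E3} (hm : ‖m‖ ≤ 1) {p : E3} (hp : p ∈ Sites₀ (anchorDatum t τ) A) :
    ‖vField t A τ u p - m‖ ^ 2 ≤ 121 / 100 := by
  have h := norm_vField_sub_const_le hA hI hIτ hu hm hp
  nlinarith [norm_nonneg (vField t A τ u p - m)]

/-- `‖χ_q² • (v q − m)‖ ≤ 11/10`. [folklore] -/
theorem norm_sq_cutoff_smul_sub_le (hA : Adm₀ A) (hI : Inner₀ t A) (hIτ : Inner₀ (anchorDatum t τ) A)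
    (hu : IsDisplacement X t A u) {m : E3} (hm : ‖m‖ ≤ 1) (c : E3) (R : ℝ) (q : Sites₀ (anchorDatum t τ) A) :
    ‖cutoff (Sites₀ (anchorDatum t τ) A) c R q ^ 2 • (vField t A τ u q - m)‖ ≤ 11 / 10 := by
  rw [norm_smul, Real.norm_eq_abs, abs_of_nonneg (sq_nonneg _)]
  have h0 := cutoff_nonneg (Sites₀ (anchorDatum t τ) A) c R q
  have h1 := cutoff_le_one (Sites₀ (anchorDatum t τ) A) c R q
  have h2 := norm_vField_sub_const_le hA hI hIτ hu hm q.2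
  have h3 : cutoff (Sites₀ (anchorDatum t τ) A) c R q ^ 2 ≤ 1 := by nlinarith
  calc cutoff (Sites₀ (anchorDatum t τ) A) c R q ^ 2 * ‖vField t A τ u q - m‖ ≤ 1 * (11 / 10) :=
      mul_le_mul h3 h2 (norm_nonneg _) zero_le_one
    _ = 11 / 10 := one_mul _

/-! ## The first part: summation by parts (verbatim from level 1, `v_q` replaced by `v_q − m`) -/

/-- The column family `p ↦ B_pq(v p − v q, χ_q² (v_q − m))` is summable. [folklore] -/
theorem summable_first_col_sub (hA : Adm₀ A) (hI : Inner₀ t A) (hIτ : Inner₀ (anchorDatum t τ) A)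
    (hu : IsDisplacement X t A u) {m : E3} (hm : ‖m‖ ≤ 1) (c : E3) (R : ℝ) (q : Sites₀ (anchorDatum t τ) A) :
    Summable fun p : Sites₀ (anchorDatum t τ) A =>
      secK (p - q) (vField t A τ u p - vField t A τ u q) (vField t A τ u p - vField t A τ u q)
        (cutoff (Sites₀ (anchorDatum t τ) A) c R q ^ 2 • (vField t A τ u q - m)) := by
  have h := (summable_row hA hI hIτ hu q.2 (fun p => vField t A τ u q - vField t A τ u p)
    (fun _ => cutoff (Sites₀ (anchorDatum t τ) A) c R q ^ 2 • (vField t A τ u q - m))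
    (fun p => norm_vField_sub_le hA hI hIτ hu q.2 p.2)
    (fun _ => norm_sq_cutoff_smul_sub_le hA hI hIτ hu hm c R q)).neg
  refine h.congr fun p => ?_
  rw [B_antisymm (vField t A τ u) p q]

/-- Rows of the first part are finite sums over the sites of `B_{2R}(c)`. [folklore] -/
theorem first_row_eq_sum_sub (hA : Adm₀ A) (hIτ : Inner₀ (anchorDatum t τ) A) (c : E3) {R : ℝ} (hR : 0 < R)
    (m : E3) (p : Sites₀ (anchorDatum t τ) A) :
    ∑' q : Sites₀ (anchorDatum t τ) A,
        secK (p - q) (vField t A τ u p - vField t A τ u q) (vField t A τ u p - vField t A τ u q)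
          (cutoff (Sites₀ (anchorDatum t τ) A) c R q ^ 2 • (vField t A τ u q - m)) =
      ∑ q ∈ (finite_sites_ball hA hIτ c (2 * R)).toFinset,
        secK (p - q) (vField t A τ u p - vField t A τ u q) (vField t A τ u p - vField t A τ u q)
          (cutoff (Sites₀ (anchorDatum t τ) A) c R q ^ 2 • (vField t A τ u q - m)) := by
  refine tsum_eq_sum fun q hq => ?_
  have hfar : 2 * R ≤ dist (q : E3) c := by
    by_contra h
    exact hq ((Set.Finite.mem_toFinset _).2 (le_of_lt (not_le.1 h)))
  rw [cutoff_eq_zero_of_le hR hfar]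
  simp

/-- **Summation by parts**: `Σ_p Σ_q B_pq(v p − v q, χ_q² (v_q − m)) = 0`. [folklore] -/
theorem tsum_first_part_sub_eq_zero (hA : Adm₀ A) (hI : Inner₀ t A) (hIτ : Inner₀ (anchorDatum t τ) A)
    (hu : IsDisplacement X t A u) (hEX : Equil₀ X) (hEτ : Equil₀ (Sites₀ (anchorDatum t τ) A))
    {m : E3} (hm : ‖m‖ ≤ 1) (c : E3) {R : ℝ} (hR : 0 < R) :
    ∑' p : Sites₀ (anchorDatum t τ) A, ∑' q : Sites₀ (anchorDatum t τ) A,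
        secK (p - q) (vField t A τ u p - vField t A τ u q) (vField t A τ u p - vField t A τ u q)
          (cutoff (Sites₀ (anchorDatum t τ) A) c R q ^ 2 • (vField t A τ u q - m)) = 0 := by
  rw [tsum_congr (first_row_eq_sum_sub (u := u) hA hIτ c hR m)]
  rw [Summable.tsum_finsetSum fun q _ => summable_first_col_sub hA hI hIτ hu hm c R q]
  refine Finset.sum_eq_zero fun q _ => ?_
  rw [tsum_congr fun p : Sites₀ (anchorDatum t τ) A => B_antisymm (vField t A τ u) (p : E3) q
    (cutoff (Sites₀ (anchorDatum t τ) A) c R q ^ 2 • (vField t A τ u q - m)), tsum_neg,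
    tsum_linear_eq hA hI hIτ hu hEX hEτ q.2, neg_zero]

/-- The first part, row by row, is a summable family of `p`. [folklore] -/
theorem summable_first_part_sub (hA : Adm₀ A) (hI : Inner₀ t A) (hIτ : Inner₀ (anchorDatum t τ) A)
    (hu : IsDisplacement X t A u) {m : E3} (hm : ‖m‖ ≤ 1) (c : E3) {R : ℝ} (hR : 0 < R) :
    Summable fun p : Sites₀ (anchorDatum t τ) A => ∑' q : Sites₀ (anchorDatum t τ) A,
        secK (p - q) (vField t A τ u p - vField t A τ u q) (vField t A τ u p - vField t A τ u q)
          (cutoff (Sites₀ (anchorDatum t τ) A) c R q ^ 2 • (vField t A τ u q - m)) :=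
  (summable_sum fun q _ => summable_first_col_sub hA hI hIτ hu hm c R q).congr fun p =>
    (first_row_eq_sum_sub (u := u) hA hIτ c hR m p).symm

/-! ## The row identity for the test field `χ • (v − m)` -/

/-- **The cut-off identity summed over a row** (`p ∈ S*`), test field `χ•(v − m)`:
`Σ_q B_pq(D(χ(v−m)), D(χ(v−m))) = −Σ_q B_pq(Dv, χ_q² (v_q − m)) + Σ_q (χ_p − χ_q)² B_pq(v_p − m, v_q − m)`.
[folklore] -/
theorem row_identity_sub (hA : Adm₀ A) (hI : Inner₀ t A) (hIτ : Inner₀ (anchorDatum t τ) A)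
    (hu : IsDisplacement X t A u) (hEX : Equil₀ X) (hEτ : Equil₀ (Sites₀ (anchorDatum t τ) A))
    (c : E3) (R : ℝ) {m : E3} (hm : ‖m‖ ≤ 1) {p : E3} (hp : p ∈ Sites₀ (anchorDatum t τ) A) :
    ∑' q : Sites₀ (anchorDatum t τ) A,
        secK (p - q) (vField t A τ u p - vField t A τ u q)
          (cutoff (Sites₀ (anchorDatum t τ) A) c R p • (vField t A τ u p - m) -
            cutoff (Sites₀ (anchorDatum t τ) A) c R q • (vField t A τ u q - m))
          (cutoff (Sites₀ (anchorDatum t τ) A) c R p • (vField t A τ u p - m) -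
            cutoff (Sites₀ (anchorDatum t τ) A) c R q • (vField t A τ u q - m)) =
      -(∑' q : Sites₀ (anchorDatum t τ) A,
          secK (p - q) (vField t A τ u p - vField t A τ u q) (vField t A τ u p - vField t A τ u q)
            (cutoff (Sites₀ (anchorDatum t τ) A) c R q ^ 2 • (vField t A τ u q - m))) +
        ∑' q : Sites₀ (anchorDatum t τ) A,
          (cutoff (Sites₀ (anchorDatum t τ) A) c R p - cutoff (Sites₀ (anchorDatum t τ) A) c R q) ^ 2 *
            secK (p - q) (vField t A τ u p - vField t A τ u q) (vField t A τ u p - m) (vField t A τ u q - m) := by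
  set S' := Sites₀ (anchorDatum t τ) A with hS'
  set v := vField t A τ u with hv
  set χ := cutoff S' c R with hχ
  have h1 : Summable fun q : S' => secK (p - q) (v p - v q) (v p - v q) (χ p ^ 2 • (v p - m)) :=
    summable_row hA hI hIτ hu hp (fun q => v p - v q) (fun _ => χ p ^ 2 • (v p - m))
      (fun q => norm_vField_sub_le hA hI hIτ hu hp q.2)
      (fun _ => norm_sq_cutoff_smul_sub_le hA hI hIτ hu hm c R ⟨p, hp⟩)
  have h2 : Summable fun q : S' => secK (p - q) (v p - v q) (v p - v q) (χ q ^ 2 • (v q - m)) :=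
    summable_row hA hI hIτ hu hp (fun q => v p - v q) (fun q => χ q ^ 2 • (v q - m))
      (fun q => norm_vField_sub_le hA hI hIτ hu hp q.2) (fun q => norm_sq_cutoff_smul_sub_le hA hI hIτ hu hm c R q)
  have h3 : Summable fun q : S' => (χ p - χ q) ^ 2 * secK (p - q) (v p - v q) (v p - m) (v q - m) := by
    have h := summable_row hA hI hIτ hu hp (fun q => (χ p - χ q) ^ 2 • (v p - m)) (fun q => v q - m)
      (c := 11 / 10) (c' := 11 / 10) ?_ (fun q => norm_vField_sub_const_le hA hI hIτ hu hm q.2)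
    · refine h.congr fun q => ?_
      exact secK_smul_left _ _ _ _ _
    · intro q
      rw [norm_smul, Real.norm_eq_abs, abs_of_nonneg (sq_nonneg _)]
      calc (χ p - χ q) ^ 2 * ‖v p - m‖ ≤ 1 * (11 / 10) :=
          mul_le_mul (sq_cutoff_sub_le_one S' c R p q) (norm_vField_sub_const_le hA hI hIτ hu hm hp)
            (norm_nonneg _) zero_le_one
        _ = 11 / 10 := one_mul _
  have hpt : ∀ q : S', secK (p - q) (v p - v q) (χ p • (v p - m) - χ q • (v q - m))
      (χ p • (v p - m) - χ q • (v q - m)) =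
      (secK (p - q) (v p - v q) (v p - v q) (χ p ^ 2 • (v p - m)) -
          secK (p - q) (v p - v q) (v p - v q) (χ q ^ 2 • (v q - m))) +
        (χ p - χ q) ^ 2 * secK (p - q) (v p - v q) (v p - m) (v q - m) := by
    intro q
    rw [B_cutoff_identity hA hI hIτ hu hp q.2 (χ p) (χ q) (v p - m) (v q - m) (fun h => by rw [h]),
      sub_sub_sub_cancel_right, B_sub_right hA hI hIτ hu hp q.2]
  rw [tsum_congr hpt, Summable.tsum_add (h1.sub h2) h3, Summable.tsum_sub h1 h2,
    tsum_linear_eq hA hI hIτ hu hEX hEτ hp, zero_sub]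

/-! ## The second part, keeping the squares `‖v p − m‖²` -/

/-- Pointwise: `(χ_p − χ_q)² k(p,q) ‖v q − m‖² ≤ (121/100)·(χ_p − χ_q)² k(p,q)`. [folklore] -/
theorem weight_mul_sq_le (hA : Adm₀ A) (hI : Inner₀ t A) (hIτ : Inner₀ (anchorDatum t τ) A)
    (hu : IsDisplacement X t A u) {m : E3} (hm : ‖m‖ ≤ 1) (c : E3) (R : ℝ) (p : E3)
    (q : Sites₀ (anchorDatum t τ) A) :
    (cutoff (Sites₀ (anchorDatum t τ) A) c R p - cutoff (Sites₀ (anchorDatum t τ) A) c R q) ^ 2 * ker p q *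
        ‖vField t A τ u q - m‖ ^ 2 ≤
      121 / 100 * ((cutoff (Sites₀ (anchorDatum t τ) A) c R p - cutoff (Sites₀ (anchorDatum t τ) A) c R q) ^ 2 *
        ker p q) := by
  have hx := sq_norm_vField_sub_const_le hA hI hIτ hu hm q.2
  have h0 : 0 ≤ (cutoff (Sites₀ (anchorDatum t τ) A) c R p - cutoff (Sites₀ (anchorDatum t τ) A) c R q) ^ 2 *
      ker p q := mul_nonneg (sq_nonneg _) (ker_nonneg _ _)
  nlinarith

/-- The row `q ↦ (χ_p − χ_q)² k(p,q) ‖v q − m‖²` is summable. [folklore] -/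
theorem summable_weight_mul_sq (hA : Adm₀ A) (hI : Inner₀ t A) (hIτ : Inner₀ (anchorDatum t τ) A)
    (hu : IsDisplacement X t A u) {m : E3} (hm : ‖m‖ ≤ 1) (c : E3) (R : ℝ) {p : E3}
    (hp : p ∈ Sites₀ (anchorDatum t τ) A) :
    Summable fun q : Sites₀ (anchorDatum t τ) A =>
      (cutoff (Sites₀ (anchorDatum t τ) A) c R p - cutoff (Sites₀ (anchorDatum t τ) A) c R q) ^ 2 * ker p q *
        ‖vField t A τ u q - m‖ ^ 2 :=
  ((summable_weight hA hIτ c R hp).mul_left (121 / 100)).of_nonneg_of_le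
    (fun _ => mul_nonneg (mul_nonneg (sq_nonneg _) (ker_nonneg _ _)) (sq_nonneg _))
    (fun q => weight_mul_sq_le hA hI hIτ hu hm c R p q)

/-- **Row bound for the second part keeping the squares**:
`|Σ_q (χ_p − χ_q)² B_pq(v_p − m, v_q − m)| ≤ ½(‖v_p − m‖² Σ_q (χ_p − χ_q)² k(p,q) + Σ_q (χ_p − χ_q)² k(p,q) ‖v_q − m‖²)`.
[folklore] -/
theorem abs_T_sub_le_half (hA : Adm₀ A) (hI : Inner₀ t A) (hIτ : Inner₀ (anchorDatum t τ) A)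
    (hu : IsDisplacement X t A u) {m : E3} (hm : ‖m‖ ≤ 1) (c : E3) (R : ℝ) {p : E3}
    (hp : p ∈ Sites₀ (anchorDatum t τ) A) :
    |∑' q : Sites₀ (anchorDatum t τ) A,
        (cutoff (Sites₀ (anchorDatum t τ) A) c R p - cutoff (Sites₀ (anchorDatum t τ) A) c R q) ^ 2 *
          secK (p - q) (vField t A τ u p - vField t A τ u q) (vField t A τ u p - m) (vField t A τ u q - m)| ≤
      (‖vField t A τ u p - m‖ ^ 2 * ∑' q : Sites₀ (anchorDatum t τ) A,
          (cutoff (Sites₀ (anchorDatum t τ) A) c R p - cutoff (Sites₀ (anchorDatum t τ) A) c R q) ^ 2 * ker p q +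
        ∑' q : Sites₀ (anchorDatum t τ) A,
          (cutoff (Sites₀ (anchorDatum t τ) A) c R p - cutoff (Sites₀ (anchorDatum t τ) A) c R q) ^ 2 * ker p q *
            ‖vField t A τ u q - m‖ ^ 2) / 2 := by
  rw [← Real.norm_eq_abs]
  refine tsum_of_norm_bounded ((((summable_weight hA hIτ c R hp).hasSum.mul_left
    (‖vField t A τ u p - m‖ ^ 2)).add (summable_weight_mul_sq hA hI hIτ hu hm c R hp).hasSum).div_const 2)
    fun q => ?_
  rw [Real.norm_eq_abs, abs_mul, abs_of_nonneg (sq_nonneg _)]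
  have hB := abs_B_le hA hI hIτ hu hp q.2 (vField t A τ u p - m) (vField t A τ u q - m)
  have hk := ker_nonneg p q
  have h2 := two_mul_le_add_sq ‖vField t A τ u p - m‖ ‖vField t A τ u q - m‖
  have hχ := sq_nonneg (cutoff (Sites₀ (anchorDatum t τ) A) c R p - cutoff (Sites₀ (anchorDatum t τ) A) c R q)
  calc (cutoff (Sites₀ (anchorDatum t τ) A) c R p - cutoff (Sites₀ (anchorDatum t τ) A) c R q) ^ 2 *
        |secK (p - q) (vField t A τ u p - vField t A τ u q) (vField t A τ u p - m) (vField t A τ u q - m)|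
      ≤ (cutoff (Sites₀ (anchorDatum t τ) A) c R p - cutoff (Sites₀ (anchorDatum t τ) A) c R q) ^ 2 *
          (ker p q * ‖vField t A τ u p - m‖ * ‖vField t A τ u q - m‖) := mul_le_mul_of_nonneg_left hB hχ
    _ ≤ (cutoff (Sites₀ (anchorDatum t τ) A) c R p - cutoff (Sites₀ (anchorDatum t τ) A) c R q) ^ 2 *
          (ker p q * ((‖vField t A τ u p - m‖ ^ 2 + ‖vField t A τ u q - m‖ ^ 2) / 2)) := by
        refine mul_le_mul_of_nonneg_left ?_ hχ
        rw [mul_assoc]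
        exact mul_le_mul_of_nonneg_left (by linarith) hk
    _ = (‖vField t A τ u p - m‖ ^ 2 *
          ((cutoff (Sites₀ (anchorDatum t τ) A) c R p - cutoff (Sites₀ (anchorDatum t τ) A) c R q) ^ 2 * ker p q) +
          (cutoff (Sites₀ (anchorDatum t τ) A) c R p - cutoff (Sites₀ (anchorDatum t τ) A) c R q) ^ 2 * ker p q *
            ‖vField t A τ u q - m‖ ^ 2) / 2 := by ring

/-- **Row bound for the second part**: `|Σ_q (χ_p − χ_q)² B_pq(v_p − m, v_q − m)| ≤ (121/100)·Σ_q (χ_p − χ_q)² k(p,q)`.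
[folklore] -/
theorem abs_T_sub_le (hA : Adm₀ A) (hI : Inner₀ t A) (hIτ : Inner₀ (anchorDatum t τ) A)
    (hu : IsDisplacement X t A u) {m : E3} (hm : ‖m‖ ≤ 1) (c : E3) (R : ℝ) {p : E3}
    (hp : p ∈ Sites₀ (anchorDatum t τ) A) :
    |∑' q : Sites₀ (anchorDatum t τ) A,
        (cutoff (Sites₀ (anchorDatum t τ) A) c R p - cutoff (Sites₀ (anchorDatum t τ) A) c R q) ^ 2 *
          secK (p - q) (vField t A τ u p - vField t A τ u q) (vField t A τ u p - m) (vField t A τ u q - m)| ≤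
      121 / 100 * ∑' q : Sites₀ (anchorDatum t τ) A,
        (cutoff (Sites₀ (anchorDatum t τ) A) c R p - cutoff (Sites₀ (anchorDatum t τ) A) c R q) ^ 2 * ker p q := by
  have h1 := abs_T_sub_le_half hA hI hIτ hu hm c R hp
  have h2 : ∑' q : Sites₀ (anchorDatum t τ) A,
      (cutoff (Sites₀ (anchorDatum t τ) A) c R p - cutoff (Sites₀ (anchorDatum t τ) A) c R q) ^ 2 * ker p q *
        ‖vField t A τ u q - m‖ ^ 2 ≤
      121 / 100 * ∑' q : Sites₀ (anchorDatum t τ) A,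
        (cutoff (Sites₀ (anchorDatum t τ) A) c R p - cutoff (Sites₀ (anchorDatum t τ) A) c R q) ^ 2 * ker p q := by
    rw [← tsum_mul_left]
    exact Summable.tsum_le_tsum (fun q => weight_mul_sq_le hA hI hIτ hu hm c R p q)
      (summable_weight_mul_sq hA hI hIτ hu hm c R hp) ((summable_weight hA hIτ c R hp).mul_left _)
  have h3 := sq_norm_vField_sub_const_le hA hI hIτ hu hm hp
  have hW : 0 ≤ ∑' q : Sites₀ (anchorDatum t τ) A,
      (cutoff (Sites₀ (anchorDatum t τ) A) c R p - cutoff (Sites₀ (anchorDatum t τ) A) c R q) ^ 2 * ker p q :=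
    tsum_nonneg fun q => mul_nonneg (sq_nonneg _) (ker_nonneg _ _)
  have h4 := mul_le_mul_of_nonneg_right h3 hW
  linarith

/-- The second part, row by row, is a summable family of `p`. [folklore] -/
theorem summable_T_sub (hA : Adm₀ A) (hI : Inner₀ t A) (hIτ : Inner₀ (anchorDatum t τ) A)
    (hu : IsDisplacement X t A u) {m : E3} (hm : ‖m‖ ≤ 1) (c : E3) {R : ℝ} (hR : 0 < R) :
    Summable fun p : Sites₀ (anchorDatum t τ) A => ∑' q : Sites₀ (anchorDatum t τ) A,
        (cutoff (Sites₀ (anchorDatum t τ) A) c R p - cutoff (Sites₀ (anchorDatum t τ) A) c R q) ^ 2 *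
          secK (p - q) (vField t A τ u p - vField t A τ u q) (vField t A τ u p - m) (vField t A τ u q - m) := by
  set P := (finite_sites_ball hA hIτ c (2 * R)).toFinset with hP
  set P₃ := (finite_sites_ball hA hIτ c (3 * R)).toFinset with hP₃
  have hmemP₃ : ∀ q : Sites₀ (anchorDatum t τ) A, q ∈ P₃ ↔ dist (q : E3) c ≤ 3 * R := fun q => by
    rw [hP₃, Set.Finite.mem_toFinset]; rfl
  set g : Sites₀ (anchorDatum t τ) A → ℝ := fun p =>
    121 / 100 * ((if p ∈ P₃ then K₀ else 0) + ∑ q ∈ P, ker (q : E3) p) with hg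
  have hg1 : Summable fun p : Sites₀ (anchorDatum t τ) A => (if p ∈ P₃ then K₀ else 0) :=
    summable_of_ne_finset_zero (s := P₃) fun p hp => if_neg hp
  have hg2 : Summable fun p : Sites₀ (anchorDatum t τ) A => ∑ q ∈ P, ker (q : E3) p :=
    summable_sum fun q _ => summable_ker hA hIτ q.2
  have hgs : Summable g := (hg1.add hg2).mul_left _
  refine Summable.of_norm_bounded hgs fun p => ?_
  rw [Real.norm_eq_abs]
  refine (abs_T_sub_le hA hI hIτ hu hm c R p.2).trans ?_
  refine mul_le_mul_of_nonneg_left ?_ (by norm_num)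
  by_cases h3 : p ∈ P₃
  · rw [if_pos h3]
    have h1 := tsum_weight_le_K₀ hA hIτ c R p.2
    have h2 : 0 ≤ ∑ q ∈ P, ker (q : E3) p := Finset.sum_nonneg fun q _ => ker_nonneg _ _
    linarith
  · rw [if_neg h3, zero_add]
    have hpc : 3 * R < dist (p : E3) c := not_le.1 fun h => h3 ((hmemP₃ p).2 h)
    refine (tsum_weight_far_le hA hIτ c hR hpc).trans ?_
    exact Finset.sum_le_sum fun q _ => by split_ifs; exacts [le_rfl, ker_nonneg _ _]

/-! ## Counting bound for the squared oscillation -/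

/-- **Counting bound**: `oscAt (Sites₀ t A) v c r m ≤ b·32r³` if `‖v − m‖² ≤ b` on the sites (`r ≥ 1`,
`#(S ∩ B_r) ≤ 32r³`). [folklore] -/
theorem oscAt_le_of_sq_le (hA : Adm₀ A) (hI : Inner₀ t A) (v : E3 → E3) {m : E3} {b : ℝ}
    (hv : ∀ p ∈ Sites₀ t A, ‖v p - m‖ ^ 2 ≤ b) (hb : 0 ≤ b) (c : E3) {r : ℝ} (hr : 1 ≤ r) :
    oscAt (Sites₀ t A) v c r m ≤ b * (32 * r ^ 3) := by
  rw [oscAt_eq_tsum_ite]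
  refine tsum_le_of_sum_le' (by positivity) fun F => ?_
  rw [← Finset.sum_filter]
  have hcard : ((F.filter fun p : Sites₀ t A => dist (p : E3) c ≤ r).card : ℝ) ≤ 32 * r ^ 3 :=
    card_sites_le hA hI c hr _ fun q hq => (Finset.mem_filter.1 hq).2
  calc ∑ p ∈ F.filter (fun p : Sites₀ t A => dist (p : E3) c ≤ r), ‖v p - m‖ ^ 2
      ≤ (F.filter fun p : Sites₀ t A => dist (p : E3) c ≤ r).card • b :=
        Finset.sum_le_card_nsmul _ _ _ fun p _ => hv _ p.2
    _ = ((F.filter fun p : Sites₀ t A => dist (p : E3) c ≤ r).card : ℝ) * b := nsmul_eq_mul _ _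
    _ ≤ 32 * r ^ 3 * b := mul_le_mul_of_nonneg_right hcard hb
    _ = b * (32 * r ^ 3) := mul_comm _ _

end Blowdown

/-- Registered sub-goal carrying this helper file (crux stmt-AtomisticToContinuum-9332, line `Sketch`, skeleton v4;
helper of `stub_caccioppoli`): summation by parts for the secant matrices tested against `χ²(v − m)`,
`Σ_p Σ_q B_pq(v p − v q, χ_q² (v_q − m)) = 0`. [folklore] -/
theorem blowdown_secantRows : ∀ (X : Set E3) (t : Fin 2 → E3) (A : E3 →L[ℝ] E3) (u : E3 → E3) (τ : E3), Adm₀ A → Inner₀ t A → Inner₀ (anchorDatum t τ) A → IsDisplacement X t A u → Equil₀ X → Equil₀ (Sites₀ (anchorDatum t τ) A) → ∀ (c : E3) (R : ℝ) (m : E3), 0 < R → ‖m‖ ≤ 1 → ∑' p : Sites₀ (anchorDatum t τ) A, ∑' q : Sites₀ (anchorDatum t τ) A, LevelOne.secK (p - q) (LevelOne.vField t A τ u p - LevelOne.vField t A τ u q) (LevelOne.vField t A τ u p - LevelOne.vField t A τ u q) (LevelOne.cutoff (Sites₀ (anchorDatum t τ) A) c R q ^ 2 • (LevelOne.vField t A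 τ u q - m)) = 0 := by
  intro X t A u τ hA hI hIτ hu hEX hEτ c R m hR hm
  exact Blowdown.tsum_first_part_sub_eq_zero hA hI hIτ hu hEX hEτ hm c hR

end Summit.AtomisticToContinuum.Crystallization.Theorems.ExcessDecayLiouville

end
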